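import Literature.NumberTheory.Transcendental.CurvePeriodsChartPathsProofs
import Literature.NumberTheory.Transcendental.CurvePeriodsAlgebraicPointsProofs
import Mathlib.Topology.MetricSpace.Pseudo.Lemmas
import HarnessLib

/-!
# Periods of curve type: `C¹` paths with algebraic break points inside an open set

Companion of `Literature/NumberTheory/Transcendental/CurvePeriods.lean` (Huber–Wüstholz 2022,
Thm. 13.3 (2), rendered on explicit period symbols `(Z, ω, γ)`; the general statement is the named
fact `HuberWustholzCurvePeriods`). The paths of the rendering are `C¹` paths on `Z(ℂ)` with
ALGEBRAIC end points (`CurvePath`), while relative singular homology is built from continuous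
paths with arbitrary break points. This file bridges the two, for every embedded smooth affine
curve `Z` over `ℚ̄`:

* `exists_localChart_of_minor_subset`, `exists_localChart_subset` — holomorphic charts of `Z`
  (`CurvePeriodsChartsProofs.lean`) inside any prescribed open neighbourhood;
* `CurvePath.concat_mem` — the concatenation of two paths stays in any set containing both;
* `exists_curvePath_subset` — **if two algebraic points of `Z` are joined by a continuous path in
  `Z(ℂ) ∩ G`, `G ⊂ ℂⁿ` open, they are joined by a `C¹` path (a `CurvePath`) in `Z(ℂ) ∩ G`**:
  cover the path by charts inside `G`, cut `[0,1]` into `N` pieces each mapped into one chart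
  (Lebesgue number), replace the break points by nearby ALGEBRAIC points of `Z` in the overlap
  of consecutive charts (`Z(ℚ̄)` is dense, `CurvePeriodsAlgebraicPointsProofs.lean`), join
  consecutive ones by chart-straight `C¹` paths (`chartSegment`) and concatenate
  (`CurvePath.concat`, `C¹` thanks to the smooth-step reparametrisation).

This is the form in which "`H₁^sing(Z^an, D; ℚ)` is generated by smooth paths with end points
in `D`" (book §3.3.1) is used when a continuous homotopy or `2`-chain is cut into cells.

## References

* A. Huber, G. Wüstholz, *Transcendence and Linear Relations of 1-Periods*, Cambridge Tracts in
  Mathematics 227, CUP 2022 [HuberWustholz2022]: §3.3.1 (pp. 42–44 of the held text), Thm. 13.3 (2)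
  (p. 121).
-/

noncomputable section

open scoped BigOperators Topology
open MvPolynomial Set Filter

namespace Literature.NumberTheory.Transcendental

namespace CurvePeriods

variable {Z : CurveData}

/-! ### Charts inside a prescribed open set -/

/-- **Local chart over a prescribed coordinate, inside a prescribed open set.** As
`exists_localChart_of_minor`, with moreover `Ω ⊆ G` for a given open `G ∋ z₀`. [folklore] -/
theorem exists_localChart_of_minor_subset (hZ : Z.IsSmoothAffineCurve) {z₀ : Fin Z.n → ℂ}
    (hz₀ : z₀ ∈ Z.points) {d : ℕ} (hn : Z.n = d + 1) (j : Fin d → Fin Z.m) (a : Fin d → Fin Z.n)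
    (i₀ : Fin Z.n) (ha : Function.Injective a) (hi₀ : ∀ k, a k ≠ i₀)
    (hdet : (Matrix.of fun k l : Fin d => Z.gradient (j l) z₀ (a k)).det ≠ 0)
    {G : Set (Fin Z.n → ℂ)} (hG : IsOpen G) (hz₀G : z₀ ∈ G) :
    ∃ (ε : ℝ) (Ω : Set (Fin Z.n → ℂ)) (ψ : ℂ → (Fin Z.n → ℂ)), 0 < ε ∧ IsOpen Ω ∧
      z₀ ∈ Ω ∧ Ω ⊆ G ∧ AnalyticOnNhd ℂ ψ (Metric.ball (z₀ i₀) ε) ∧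
      (∀ z ∈ Ω, z ∈ Z.points → z i₀ ∈ Metric.ball (z₀ i₀) ε ∧ ψ (z i₀) = z) ∧
      (∀ w ∈ Metric.ball (z₀ i₀) ε, ψ w ∈ Ω ∧ ψ w ∈ Z.points ∧ ψ w i₀ = w) := by
  obtain ⟨ε, Ω, ψ, hε, hΩo, hz₀Ω, hψ, h1, h2⟩ :=
    exists_localChart_of_minor hZ hz₀ hn j a i₀ ha hi₀ hdet
  obtain ⟨_, hψ0⟩ := h1 z₀ hz₀Ω hz₀
  -- shrink the disc so that `ψ` takes values in `G`
  have hcont : ContinuousAt ψ (z₀ i₀) := (hψ (z₀ i₀) (Metric.mem_ball_self hε)).continuousAt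
  have hpre : ψ ⁻¹' G ∈ 𝓝 (z₀ i₀) := hcont.preimage_mem_nhds (hG.mem_nhds (by rw [hψ0]; exact hz₀G))
  obtain ⟨ε₁, hε₁, hball⟩ := Metric.mem_nhds_iff.mp hpre
  set ε' := min ε ε₁ with hε'
  have hε'pos : 0 < ε' := lt_min hε hε₁
  have hsub : Metric.ball (z₀ i₀) ε' ⊆ Metric.ball (z₀ i₀) ε :=
    Metric.ball_subset_ball (min_le_left _ _)
  have hsub₁ : Metric.ball (z₀ i₀) ε' ⊆ Metric.ball (z₀ i₀) ε₁ :=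
    Metric.ball_subset_ball (min_le_right _ _)
  refine ⟨ε', Ω ∩ G ∩ (fun z : Fin Z.n → ℂ => z i₀) ⁻¹' Metric.ball (z₀ i₀) ε', ψ, hε'pos,
    (hΩo.inter hG).inter (Metric.isOpen_ball.preimage (continuous_apply i₀)),
    ⟨⟨hz₀Ω, hz₀G⟩, Metric.mem_ball_self hε'pos⟩, fun z hz => hz.1.2, hψ.mono hsub,
    fun z hz hzZ => ⟨hz.2, (h1 z hz.1.1 hzZ).2⟩, fun w hw => ?_⟩
  obtain ⟨hwΩ, hwZ, hwi⟩ := h2 w (hsub hw)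
  refine ⟨⟨⟨hwΩ, hball (hsub₁ hw)⟩, ?_⟩, hwZ, hwi⟩
  show ψ w i₀ ∈ Metric.ball (z₀ i₀) ε'
  rw [hwi]
  exact hw

/-- **Local holomorphic chart inside a prescribed open set.** As `exists_localChart`, with
moreover `Ω ⊆ G` for a given open `G ∋ z₀`. [folklore] -/
theorem exists_localChart_subset (hZ : Z.IsSmoothAffineCurve) {z₀ : Fin Z.n → ℂ}
    (hz₀ : z₀ ∈ Z.points) {G : Set (Fin Z.n → ℂ)} (hG : IsOpen G) (hz₀G : z₀ ∈ G) :
    ∃ (i₀ : Fin Z.n) (ε : ℝ) (Ω : Set (Fin Z.n → ℂ)) (ψ : ℂ → (Fin Z.n → ℂ)), 0 < ε ∧ IsOpen Ω ∧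
      z₀ ∈ Ω ∧ Ω ⊆ G ∧ AnalyticOnNhd ℂ ψ (Metric.ball (z₀ i₀) ε) ∧
      (∀ z ∈ Ω, z ∈ Z.points → z i₀ ∈ Metric.ball (z₀ i₀) ε ∧ ψ (z i₀) = z) ∧
      (∀ w ∈ Metric.ball (z₀ i₀) ε, ψ w ∈ Ω ∧ ψ w ∈ Z.points ∧ ψ w i₀ = w) := by
  obtain ⟨d, hn⟩ := Nat.exists_eq_succ_of_ne_zero (n_ne_zero_of_mem hZ hz₀)
  obtain ⟨j, a, i₀, ha, hi₀, hdet⟩ := exists_jacobianMinor hZ hz₀ hn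
  exact ⟨i₀, exists_localChart_of_minor_subset hZ hz₀ hn j a i₀ ha hi₀ hdet hG hz₀G⟩

/-! ### Concatenation stays in a set -/

/-- The concatenation of two paths mapping `[0,1]` into `S` maps `[0,1]` into `S`. [folklore] -/
theorem CurvePath.concat_mem (γ₁ γ₂ : CurvePath Z) (hj : γ₁.toFun 1 = γ₂.toFun 0)
    {S : Set (Fin Z.n → ℂ)} (h₁ : ∀ t ∈ Icc (0 : ℝ) 1, γ₁.toFun t ∈ S)
    (h₂ : ∀ t ∈ Icc (0 : ℝ) 1, γ₂.toFun t ∈ S) (t : ℝ) (ht : t ∈ Icc (0 : ℝ) 1) :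
    (γ₁.concat γ₂ hj).toFun t ∈ S := by
  rw [CurvePath.concat_apply]
  split_ifs with hle
  · exact h₁ _ (mapsTo_smoothStep (two_mul_mem_Icc ⟨ht.1, hle⟩))
  · exact h₂ _ (mapsTo_smoothStep (two_mul_sub_one_mem_Icc ⟨(not_le.mp hle).le, ht.2⟩))

/-- The constant path at an algebraic point of `Z`. [folklore] -/
def CurvePath.const (p : Fin Z.n → ℂ) (hp : p ∈ Z.points) (ha : ∀ i, IsAlgebraic ℚ (p i)) :
    CurvePath Z where
  toFun := fun _ => p
  contDiffOn := contDiffOn_const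
  mem_points := fun _ _ => hp
  algebraic_zero := ha
  algebraic_one := ha

/-! ### `C¹` paths from continuous ones -/

/-- **Continuous paths in `Z ∩ G` between algebraic points can be replaced by `C¹` paths in
`Z ∩ G`.** Let `G ⊂ ℂⁿ` be open and `c : [0,1] → Z(ℂ) ∩ G` continuous with `c(0), c(1)` algebraic
points. Then there is a `C¹` path `γ` on `Z` (a `CurvePath`: algebraic end points) from `c(0)` to
`c(1)` with `γ([0,1]) ⊆ G` — a concatenation of chart-straight paths between algebraic points of
`Z` close to `c(r/N)`, `0 ≤ r ≤ N`. [cite: HuberWustholz2022, §3.3.1 (pp. 42–44)] -/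
theorem exists_curvePath_subset (hZ : Z.IsSmoothAffineCurve) {G : Set (Fin Z.n → ℂ)}
    (hG : IsOpen G) {c : ℝ → (Fin Z.n → ℂ)} (hc : ContinuousOn c (Icc 0 1))
    (hcZ : ∀ t ∈ Icc (0 : ℝ) 1, c t ∈ Z.points) (hcG : ∀ t ∈ Icc (0 : ℝ) 1, c t ∈ G)
    (hp : ∀ i, IsAlgebraic ℚ (c 0 i)) (hq : ∀ i, IsAlgebraic ℚ (c 1 i)) :
    ∃ γ : CurvePath Z, γ.toFun 0 = c 0 ∧ γ.toFun 1 = c 1 ∧ ∀ t ∈ Icc (0 : ℝ) 1, γ.toFun t ∈ G := by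
  classical
  have hI0 : (0 : ℝ) ∈ Icc (0 : ℝ) 1 := ⟨le_rfl, zero_le_one⟩
  have hI1 : (1 : ℝ) ∈ Icc (0 : ℝ) 1 := ⟨zero_le_one, le_rfl⟩
  -- charts inside `G` at the points of `Z ∩ G`
  have hch : ∀ x, x ∈ Z.points ∩ G → ∃ (i₀ : Fin Z.n) (ε : ℝ) (Ω : Set (Fin Z.n → ℂ))
      (ψ : ℂ → (Fin Z.n → ℂ)), 0 < ε ∧ IsOpen Ω ∧ x ∈ Ω ∧ Ω ⊆ G ∧
      AnalyticOnNhd ℂ ψ (Metric.ball (x i₀) ε) ∧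
      (∀ z ∈ Ω, z ∈ Z.points → z i₀ ∈ Metric.ball (x i₀) ε ∧ ψ (z i₀) = z) ∧
      (∀ w ∈ Metric.ball (x i₀) ε, ψ w ∈ Ω ∧ ψ w ∈ Z.points ∧ ψ w i₀ = w) :=
    fun x hx => exists_localChart_subset hZ hx.1 hG hx.2
  haveI : Nonempty (Fin Z.n) :=
    ⟨⟨0, Nat.pos_of_ne_zero (n_ne_zero_of_mem hZ (hcZ 0 hI0))⟩⟩
  choose! i₀ ε Ω ψ hε hΩo hxΩ hΩG hψ h1 h2 using hch
  -- an open cover of `[0,1]` in `ℝ` by preimages of the chart domains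
  have hcov : ∀ s : Icc (0 : ℝ) 1, ∃ U : Set ℝ, IsOpen U ∧ (s : ℝ) ∈ U ∧
      ∀ t ∈ U, t ∈ Icc (0 : ℝ) 1 → c t ∈ Ω (c s) := by
    intro s
    have hs : c s ∈ Z.points ∩ G := ⟨hcZ s s.2, hcG s s.2⟩
    obtain ⟨U, hUo, hU⟩ := (_root_.continuousOn_iff'.mp hc) (Ω (c s)) (hΩo _ hs)
    refine ⟨U, hUo, ?_, fun t htU ht => ?_⟩
    · have : (s : ℝ) ∈ c ⁻¹' Ω (c s) ∩ Icc (0 : ℝ) 1 := ⟨hxΩ _ hs, s.2⟩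
      rw [hU] at this
      exact this.1
    · have : t ∈ U ∩ Icc (0 : ℝ) 1 := ⟨htU, ht⟩
      rw [← hU] at this
      exact this.1
  choose U hUo hsU hU using hcov
  obtain ⟨δ, hδ, hleb⟩ := lebesgue_number_lemma_of_metric isCompact_Icc hUo
    (fun t ht => mem_iUnion.mpr ⟨⟨t, ht⟩, hsU ⟨t, ht⟩⟩)
  -- the subdivision `t_r = r / N`
  obtain ⟨N₀, hN₀⟩ := exists_nat_one_div_lt hδ
  set N : ℕ := N₀ + 1 with hN
  have hNpos : (0 : ℝ) < N := by rw [hN]; positivity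
  have hNinv : 1 / (N : ℝ) < δ := by rw [hN]; exact_mod_cast hN₀
  have htI : ∀ r : ℕ, r ≤ N → (r : ℝ) / N ∈ Icc (0 : ℝ) 1 := fun r hr =>
    ⟨by positivity, (div_le_one hNpos).mpr (by exact_mod_cast hr)⟩
  -- the chart of the `r`-th piece
  have hidx : ∀ r : ℕ, r < N → ∃ s : Icc (0 : ℝ) 1, ∀ t ∈ Icc ((r : ℝ) / N) ((r + 1 : ℝ) / N),
      c t ∈ Ω (c s) := by
    intro r hr
    obtain ⟨s, hs⟩ := hleb ((r : ℝ) / N) (htI r hr.le)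
    refine ⟨s, fun t ht => hU s t (hs ?_) ⟨(htI r hr.le).1.trans ht.1, ht.2.trans ?_⟩⟩
    · rw [Metric.mem_ball, Real.dist_eq, abs_lt]
      constructor
      · have : (0 : ℝ) ≤ t - r / N := sub_nonneg.mpr ht.1
        linarith
      · have h1 : t - r / N ≤ 1 / N := by
          have := ht.2
          rw [add_div] at this
          linarith
        linarith
    · rw [div_le_one hNpos]
      exact_mod_cast hr
  choose! s hs using hidx
  -- chart data of piece `r`: centre `x r = c (s r)`
  set x : ℕ → (Fin Z.n → ℂ) := fun r => c (s r) with hx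
  have hxZG : ∀ r, x r ∈ Z.points ∩ G := fun r => ⟨hcZ _ (s r).2, hcG _ (s r).2⟩
  have hcΩ : ∀ r, r < N → ∀ t ∈ Icc ((r : ℝ) / N) ((r + 1 : ℝ) / N), c t ∈ Ω (x r) :=
    fun r hr t ht => hs r hr t ht
  -- end points of piece `r` lie in its chart domain
  have hleft : ∀ r, r < N → c ((r : ℝ) / N) ∈ Ω (x r) := fun r hr =>
    hcΩ r hr _ ⟨le_rfl, by gcongr; linarith⟩
  have hright : ∀ r, r < N → c ((r + 1 : ℝ) / N) ∈ Ω (x r) := fun r hr =>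
    hcΩ r hr _ ⟨by gcongr; linarith, le_rfl⟩
  -- algebraic break points `p r`, `0 ≤ r ≤ N`
  have hpts : ∀ r : ℕ, ∃ p : Fin Z.n → ℂ, p ∈ Z.points ∧ (∀ i, IsAlgebraic ℚ (p i)) ∧
      (r = 0 → p = c 0) ∧ (r = N → p = c 1) ∧ (r < N → p ∈ Ω (x r)) ∧
      (0 < r → r ≤ N → p ∈ Ω (x (r - 1))) := by
    intro r
    rcases Nat.eq_zero_or_pos r with h0 | hpos
    · subst h0
      refine ⟨c 0, hcZ 0 hI0, hp, fun _ => rfl, fun h => absurd h (by rw [hN]; omega),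
        fun hr => ?_, fun h => absurd h (lt_irrefl 0)⟩
      have := hleft 0 hr
      rwa [Nat.cast_zero, zero_div] at this
    rcases lt_trichotomy r N with hlt | heq | hgt
    · -- interior break point: an algebraic point of `Z` in the overlap of two charts
      have hr1 : r - 1 < N := by omega
      have hmem : c ((r : ℝ) / N) ∈ Ω (x (r - 1)) ∩ Ω (x r) := by
        refine ⟨?_, hleft r hlt⟩
        have := hright (r - 1) hr1
        have hcast : ((r - 1 : ℕ) : ℝ) + 1 = r := by
          rw [Nat.cast_sub (by omega : 1 ≤ r)]
          push_cast
          ring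
        rwa [hcast] at this
      obtain ⟨p, hpO, hpZ, hpa⟩ := hZ.exists_algebraicPoint_mem (hcZ _ (htI r hlt.le))
        ((hΩo _ (hxZG _)).inter (hΩo _ (hxZG _))) hmem
      exact ⟨p, hpZ, hpa, fun h => absurd h (by omega), fun h => absurd h (by omega),
        fun _ => hpO.2, fun _ _ => hpO.1⟩
    · subst heq
      refine ⟨c 1, hcZ 1 hI1, hq, fun h => absurd h (by rw [hN]; omega), fun _ => rfl,
        fun h => absurd h (lt_irrefl _), fun _ _ => ?_⟩
      have := hright (N - 1) (by omega)
      have hcast : ((N - 1 : ℕ) : ℝ) + 1 = N := by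
        rw [Nat.cast_sub (by omega : 1 ≤ N)]
        push_cast
        ring
      rwa [hcast, div_self hNpos.ne'] at this
    · exact ⟨c 0, hcZ 0 hI0, hp, fun h => absurd h (by omega), fun h => absurd h (by omega),
        fun h => absurd h (by omega), fun _ h => absurd h (by omega)⟩
  choose p hpZ hpa hp0 hpN hpΩ hpΩ' using hpts
  -- the chart-straight pieces and their concatenation, by induction on `r`
  have hT : ∀ r, Convex ℝ (Metric.ball (x r (i₀ (x r))) (ε (x r))) := fun r => convex_ball _ _
  have hψZ : ∀ r, MapsTo (ψ (x r)) (Metric.ball (x r (i₀ (x r))) (ε (x r))) Z.points :=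
    fun r w hw => (h2 _ (hxZG r) w hw).2.1
  have hind : ∀ r : ℕ, r ≤ N → ∃ γ : CurvePath Z, γ.toFun 0 = p 0 ∧ γ.toFun 1 = p r ∧
      ∀ t ∈ Icc (0 : ℝ) 1, γ.toFun t ∈ G := by
    intro r
    induction r with
    | zero =>
      intro _
      refine ⟨CurvePath.const (p 0) (hpZ 0) (hpa 0), rfl, rfl, fun t _ => ?_⟩
      show p 0 ∈ G
      rw [hp0 0 rfl]
      exact hcG 0 hI0
    | succ r ih =>
      intro hr
      have hrN : r < N := Nat.lt_of_succ_le hr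
      obtain ⟨γ, hγ0, hγ1, hγG⟩ := ih hrN.le
      -- the piece from `p r` to `p (r + 1)` in chart `r`
      have hb₀ := h1 _ (hxZG r) (p r) (hpΩ r hrN) (hpZ r)
      have hb₁ := h1 _ (hxZG r) (p (r + 1)) (hpΩ' (r + 1) (Nat.succ_pos r) hr) (hpZ (r + 1))
      have ha₀ : ∀ i, IsAlgebraic ℚ (ψ (x r) (p r (i₀ (x r))) i) := fun i => by
        rw [hb₀.2]; exact hpa r i
      have ha₁ : ∀ i, IsAlgebraic ℚ (ψ (x r) (p (r + 1) (i₀ (x r))) i) := fun i => by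
        rw [hb₁.2]; exact hpa (r + 1) i
      let σ : CurvePath Z := chartSegment (hT r) (hψ _ (hxZG r)) (hψZ r) _ _ hb₀.1 hb₁.1 ha₀ ha₁
      have hσ0 : σ.toFun 0 = p r := by
        show ψ (x r) (segPoint (p r (i₀ (x r))) (p (r + 1) (i₀ (x r))) 0) = p r
        rw [segPoint_zero, hb₀.2]
      have hσ1 : σ.toFun 1 = p (r + 1) := by
        show ψ (x r) (segPoint (p r (i₀ (x r))) (p (r + 1) (i₀ (x r))) 1) = p (r + 1)
        rw [segPoint_one, hb₁.2]
      have hσG : ∀ t ∈ Icc (0 : ℝ) 1, σ.toFun t ∈ G := fun t ht =>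
        hΩG _ (hxZG r) (h2 _ (hxZG r) _ (segPoint_mem (hT r) hb₀.1 hb₁.1 ht)).1
      have hj : γ.toFun 1 = σ.toFun 0 := by rw [hγ1, hσ0]
      refine ⟨γ.concat σ hj, ?_, ?_, fun t ht => CurvePath.concat_mem γ σ hj hγG hσG t ht⟩
      · rw [CurvePath.concat_zero, hγ0]
      · rw [CurvePath.concat_one, hσ1]
  obtain ⟨γ, hγ0, hγ1, hγG⟩ := hind N le_rfl
  exact ⟨γ, by rw [hγ0, hp0 0 rfl], by rw [hγ1, hpN N rfl], hγG⟩

end CurvePeriods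

end Literature.NumberTheory.Transcendental

end
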